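import Summits.Langlands.Langlands.Theorems.PhantomRMYoshidaResiduallyYoshidaLiftingDefs

/-!
# `ResiduallyYoshidaLifting` (stmt-Langlands-13639) — Negative knowledge on STUB 3 / the datum:
# the height-one criterion at primes of residue characteristic `p` is load-bearing

From the standing crux disprover (cdisprove gen 4, 2026-08-16; `Cruxes/ResiduallyYoshidaLifting/Disproof.lean`
§6 T9).  STUB 3 `stub_stableComponentsModular` of the picked line `yoshida-divisor-selmer-count` (skeleton
sha edead940…, landed in `PhantomRMYoshidaResiduallyYoshidaLiftingDefs`) propagates modularity `K ≤ 𝔮`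
through the component graph of `Spec R` from the Yoshida divisor `Y = V(I)`, using as input, at EVERY prime
`P ⊇ I` with `dim R/P = 2`, that the minimal primes below `P` are modular — which the line's datum
(`YoshidaFamilyDatum.heightOne_criterion`) discharges by a Wiles–Lenstra numerical criterion over the
complete DVR of the Yoshida branch at `P`.  Those `P` include the primes of `Y` over `p` (residue
characteristic `p`, the "`μ`-part"), where the input `Φ_P ≤ Ψ_P` is an inequality of Iwasawa
`μ`-invariants that none of the line's sources provides (the Beilinson–Flach / Rankin–Selberg divisibilities
are proved after inverting `p` or up to `μ`).  This file records, kernel-checked, that the propagation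
statement CANNOT be re-cut to avoid them:

* `StableComponentsModularOffElt` — STUB 3 verbatim, plus a regular non-unit `t ∈ R` (intended
  `t = p · 1_R`) and the height-one hypothesis demanded only at primes `P ∌ t`;
* `not_stableComponentsModularOffElt : ¬ StableComponentsModularOffElt` — model `R = A ×_{A/ϖ} A`,
  `A = ℚ⟦X⟧⟦Y⟧⟦Z⟧`, `ϖ = Z`, `t = (ϖ, ϖ)`, `I = K = 𝔮₁`: a reduced Noetherian local ring with exactly two
  minimal primes (`minimalPrimes_eq`), both components `≅ Spec A` of dimension `3` (`ringKrullDim_A`),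
  meeting ONLY along the prime `P₀ = 𝔮₁ + 𝔮₂ = ker(R → A/ϖ)` (`sup_eq_ker`) of coheight exactly `2`
  (`ringKrullDim_quotient_crossing`) which contains `t` (`t_mem_sup`); `Spec R` is connected in dimension
  two, generic propagation and the off-`t` height-one hypothesis are vacuous, the conclusion fails at `𝔮₂`.

Meaning for the line: a stable component `C ∋ x_ρ` of `R^{ps,ord}` may cross `Y` in dimension two only
inside `V(p)` (a `μ`-type congruence); then the only access to `C` is the criterion at `P₀ ∋ p`, so STUB 1
silently contains a `μ = 0`-type input at the Yoshida divisor (or must exclude such crossings).  Hypothesis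
pricing, not an objection to STUB 3 (proved as registered). [folklore]
-/

noncomputable section

set_option linter.dupNamespace false

namespace Summit.Langlands.Langlands.Theorems.ResiduallyYoshidaLifting.Negative

open Summit.Langlands.Langlands.Cruxes.ResiduallyYoshidaLifting.YoshidaDivisorSelmerCount
  (IsConnectedInDimTwo)

/-- STUB 3 `stub_stableComponentsModular` (registered 2026-08-16T00:58:56Z, skeleton sha edead940…) with
its height-one hypothesis RESTRICTED to primes avoiding a regular non-unit `t ∈ R` (intended `t = p·1_R`);
everything else verbatim.  FALSE: `not_stableComponentsModularOffElt`. [folklore] -/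
def StableComponentsModularOffElt : Prop :=
  ∀ (R : Type) [CommRing R] [IsNoetherianRing R] [IsLocalRing R] (t : R) (I K : Ideal R),
    t ∈ nonZeroDivisors R → ¬ IsUnit t → K ≤ I →
    (∃ 𝔮 ∈ minimalPrimes R, I ≤ 𝔮) → IsConnectedInDimTwo R →
    (∀ 𝔮₁ ∈ minimalPrimes R, ∀ 𝔮₂ ∈ minimalPrimes R, ¬ I ≤ 𝔮₁ → ¬ I ≤ 𝔮₂ →
      (2 : WithBot ℕ∞) ≤ ringKrullDim (R ⧸ (𝔮₁ ⊔ 𝔮₂)) → K ≤ 𝔮₁ → K ≤ 𝔮₂) →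
    (∀ P : Ideal R, P.IsPrime → I ≤ P → ringKrullDim (R ⧸ P) = 2 → t ∉ P →
      ∀ 𝔮 ∈ minimalPrimes R, 𝔮 ≤ P → K ≤ 𝔮) →
    ∀ 𝔮 ∈ minimalPrimes R, K ≤ 𝔮

namespace CharPWitness

variable (F : Type) [Field F]

/-- `A₂ = F⟦X⟧⟦Y⟧`. [folklore] -/
abbrev A₂ : Type := PowerSeries (PowerSeries F)

/-- `A = A₂⟦Z⟧`, a Noetherian local domain of dimension `3`; `ϖ = Z`. [folklore] -/
abbrev A : Type := PowerSeries (A₂ F)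

/-- reduction modulo `ϖ`. [folklore] -/
abbrev θ : A F →+* A₂ F := PowerSeries.constantCoeff

/-- `R = A ×_{A/ϖ} A ⊆ A × A`. [folklore] -/
def R : Subring (A F × A F) :=
  RingHom.eqLocus ((θ F).comp (RingHom.fst (A F) (A F))) ((θ F).comp (RingHom.snd (A F) (A F)))

variable {F} in
/-- membership in `R`. [folklore] -/
theorem mem_R {x : A F × A F} : x ∈ R F ↔ θ F x.1 = θ F x.2 := Iff.rfl

variable {F} in
/-- the gluing condition of an element of `R`. [folklore] -/
theorem R.prop (x : R F) : θ F x.1.1 = θ F x.1.2 := x.2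

/-- the diagonal `A → R`. [folklore] -/
def diag : A F →+* R F :=
  ((RingHom.id (A F)).prod (RingHom.id (A F))).codRestrict (R F) fun _ => rfl

/-- the first projection `R → A` (`R/𝔮₁ ≅ A`). [folklore] -/
def pr₁ : R F →+* A F := (RingHom.fst (A F) (A F)).comp (R F).subtype

/-- the second projection `R → A`. [folklore] -/
def pr₂ : R F →+* A F := (RingHom.snd (A F) (A F)).comp (R F).subtype

/-- `𝔮₁ = ker pr₁` ("Yoshida" component). [folklore] -/
def 𝔮₁ : Ideal (R F) := RingHom.ker (pr₁ F)

/-- `𝔮₂ = ker pr₂` ("stable" component). [folklore] -/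
def 𝔮₂ : Ideal (R F) := RingHom.ker (pr₂ F)

/-- membership in `𝔮₁`. [folklore] -/
theorem mem_𝔮₁ {x : R F} : x ∈ 𝔮₁ F ↔ x.1.1 = 0 := RingHom.mem_ker

/-- membership in `𝔮₂`. [folklore] -/
theorem mem_𝔮₂ {x : R F} : x ∈ 𝔮₂ F ↔ x.1.2 = 0 := RingHom.mem_ker

/-- `𝔮₁` is prime (`A` is a domain). [folklore] -/
instance : (𝔮₁ F).IsPrime := RingHom.ker_isPrime _

/-- `𝔮₂` is prime. [folklore] -/
instance : (𝔮₂ F).IsPrime := RingHom.ker_isPrime _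

/-- `e₁ = (ϖ, 0) ∈ 𝔮₂ ∖ 𝔮₁`. [folklore] -/
def e₁ : R F := ⟨(PowerSeries.X, 0), by simp [mem_R]⟩

/-- `e₂ = (0, ϖ) ∈ 𝔮₁ ∖ 𝔮₂`. [folklore] -/
def e₂ : R F := ⟨(0, PowerSeries.X), by simp [mem_R]⟩

/-- `t = (ϖ, ϖ) = e₁ + e₂`, the stand-in for `p · 1`. [folklore] -/
def t : R F := ⟨(PowerSeries.X, PowerSeries.X), rfl⟩

/-- `t = e₁ + e₂`. [folklore] -/
theorem t_eq : t F = e₁ F + e₂ F := Subtype.ext (by simp [e₁, e₂, t])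

/-- `𝔮₁ ⊄ 𝔮₂`. [folklore] -/
theorem not_𝔮₁_le : ¬ 𝔮₁ F ≤ 𝔮₂ F := fun h => by
  have h1 : e₂ F ∈ 𝔮₁ F := by simp [mem_𝔮₁, e₂]
  have h2 : e₂ F ∉ 𝔮₂ F := by simp [mem_𝔮₂, e₂, PowerSeries.X_ne_zero]
  exact h2 (h h1)

/-- `𝔮₂ ⊄ 𝔮₁`. [folklore] -/
theorem not_𝔮₂_le : ¬ 𝔮₂ F ≤ 𝔮₁ F := fun h => by
  have h1 : e₁ F ∈ 𝔮₂ F := by simp [mem_𝔮₂, e₁]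
  have h2 : e₁ F ∉ 𝔮₁ F := by simp [mem_𝔮₁, e₁, PowerSeries.X_ne_zero]
  exact h2 (h h1)

/-- every prime contains `𝔮₁` or `𝔮₂` (`𝔮₁ ∩ 𝔮₂ = 0`). [folklore] -/
theorem le_or_le {P : Ideal (R F)} (hP : P.IsPrime) : 𝔮₁ F ≤ P ∨ 𝔮₂ F ≤ P := by
  have hinf : 𝔮₁ F ⊓ 𝔮₂ F = ⊥ := by
    refine le_bot_iff.mp fun x hx => ?_
    rw [Ideal.mem_bot]
    exact Subtype.ext (Prod.ext ((mem_𝔮₁ F).1 hx.1) ((mem_𝔮₂ F).1 hx.2))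
  exact hP.mul_le.mp (le_trans Ideal.mul_le_inf (hinf.le.trans bot_le))

/-- `R` is reduced with exactly the two minimal primes `𝔮₁, 𝔮₂`. [folklore] -/
theorem minimalPrimes_eq : minimalPrimes (R F) = {𝔮₁ F, 𝔮₂ F} := by
  ext q
  constructor
  · intro hq
    have hqP : q.IsPrime := hq.1.1
    rcases le_or_le F hqP with h | h
    · exact Or.inl (le_antisymm (hq.2 ⟨inferInstance, bot_le⟩ h) h)
    · exact Or.inr (le_antisymm (hq.2 ⟨inferInstance, bot_le⟩ h) h)
  · rintro (rfl | rfl)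
    · refine ⟨⟨inferInstance, bot_le⟩, fun y hy hle => ?_⟩
      rcases le_or_le F hy.1 with h | h
      · exact h
      · exact absurd (h.trans hle) (not_𝔮₂_le F)
    · refine ⟨⟨inferInstance, bot_le⟩, fun y hy hle => ?_⟩
      rcases le_or_le F hy.1 with h | h
      · exact absurd (h.trans hle) (not_𝔮₁_le F)
      · exact h

/-- `ψ : R → A/ϖ = A₂`. [folklore] -/
def ψ : R F →+* A₂ F := (θ F).comp (pr₁ F)

/-- `ψ` is onto. [folklore] -/
theorem ψ_surjective : Function.Surjective (ψ F) := fun a =>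
  ⟨diag F (PowerSeries.C a), by simp [ψ, pr₁, diag]⟩

/-- The crossing prime: `𝔮₁ + 𝔮₂ = ker(R → A/ϖ)`. [folklore] -/
theorem sup_eq_ker : 𝔮₁ F ⊔ 𝔮₂ F = RingHom.ker (ψ F) := by
  refine le_antisymm (sup_le (fun x hx => ?_) (fun x hx => ?_)) (fun x hx => ?_)
  · rw [RingHom.mem_ker, ψ, RingHom.comp_apply]
    change θ F x.1.1 = 0
    rw [(mem_𝔮₁ F).1 hx, map_zero]
  · rw [RingHom.mem_ker, ψ, RingHom.comp_apply]
    change θ F x.1.1 = 0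
    rw [R.prop x, (mem_𝔮₂ F).1 hx, map_zero]
  · have h1 : θ F x.1.1 = 0 := hx
    have h2 : θ F x.1.2 = 0 := (R.prop x) ▸ h1
    let a : R F := ⟨(0, x.1.2), by rw [mem_R]; simp [h2]⟩
    let b : R F := ⟨(x.1.1, 0), by rw [mem_R]; simp [h1]⟩
    have hx' : x = a + b := Subtype.ext (Prod.ext (by simp [a, b]) (by simp [a, b]))
    rw [hx']
    exact Submodule.add_mem_sup ((mem_𝔮₁ F).2 rfl) ((mem_𝔮₂ F).2 rfl)

/-- `P₀ = 𝔮₁ + 𝔮₂` is prime. [folklore] -/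
instance : (𝔮₁ F ⊔ 𝔮₂ F).IsPrime := by
  rw [sup_eq_ker]; exact RingHom.ker_isPrime _

/-- `ker(constantCoeff) = (X)`. [folklore] -/
theorem ker_constantCoeff_eq_span (B : Type) [CommRing B] :
    RingHom.ker (PowerSeries.constantCoeff (R := B)) = Ideal.span {PowerSeries.X} := by
  ext f
  rw [RingHom.mem_ker, Ideal.mem_span_singleton, PowerSeries.X_dvd_iff]

/-- `dim B⟦X⟧ = dim B + 1` for a Noetherian local domain `B`. [folklore] -/
theorem ringKrullDim_powerSeries (B : Type) [CommRing B] [IsNoetherianRing B] [IsLocalRing B]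
    [IsDomain B] : ringKrullDim (PowerSeries B) = ringKrullDim B + 1 := by
  have hX : (PowerSeries.X : PowerSeries B) ∈ IsLocalRing.maximalIdeal (PowerSeries B) := by
    rw [IsLocalRing.mem_maximalIdeal, mem_nonunits_iff, PowerSeries.isUnit_iff_constantCoeff,
      PowerSeries.constantCoeff_X]
    exact not_isUnit_zero
  have h := ringKrullDim_quotient_span_singleton_succ_eq_ringKrullDim_of_mem_nonZeroDivisors
    (R := PowerSeries B) MvPowerSeries.X_mem_nonzeroDivisors hX
  have h' : ringKrullDim (PowerSeries B ⧸ Ideal.span {(PowerSeries.X : PowerSeries B)}) + 1 =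
      ringKrullDim (PowerSeries B) := h
  have e : (PowerSeries B ⧸ Ideal.span {(PowerSeries.X : PowerSeries B)}) ≃+* B :=
    (Ideal.quotEquivOfEq (ker_constantCoeff_eq_span B).symm).trans
      (RingHom.quotientKerEquivOfSurjective PowerSeries.constantCoeff_surj)
  rw [← h', ringKrullDim_eq_of_ringEquiv e]

/-- `dim F⟦X⟧⟦Y⟧ = 2`. [folklore] -/
theorem ringKrullDim_A₂ : ringKrullDim (A₂ F) = 2 := by
  have h1 : ringKrullDim (PowerSeries F) = 1 := by
    rw [ringKrullDim_powerSeries F, ringKrullDim_eq_zero_of_field]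
    norm_num
  show ringKrullDim (PowerSeries (PowerSeries F)) = 2
  rw [ringKrullDim_powerSeries (PowerSeries F), h1]
  norm_num

/-- `dim A = 3`: both components `V(𝔮ᵢ) ≅ Spec A` are of full dimension, as `Y` and `C` are. [folklore] -/
theorem ringKrullDim_A : ringKrullDim (A F) = 3 := by
  show ringKrullDim (PowerSeries (A₂ F)) = 3
  rw [ringKrullDim_powerSeries (A₂ F), ringKrullDim_A₂]
  norm_num

/-- The crossing prime has coheight EXACTLY `2` — it is one of the primes the datum's
`heightOne_criterion` ranges over. [folklore] -/
theorem ringKrullDim_quotient_crossing : ringKrullDim (R F ⧸ (𝔮₁ F ⊔ 𝔮₂ F)) = 2 := by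
  have e : (R F ⧸ (𝔮₁ F ⊔ 𝔮₂ F)) ≃+* A₂ F :=
    (Ideal.quotEquivOfEq (sup_eq_ker F)).trans (RingHom.quotientKerEquivOfSurjective (ψ_surjective F))
  rw [ringKrullDim_eq_of_ringEquiv e, ringKrullDim_A₂]

/-- A unit first coordinate makes an element of `R` a unit. [folklore] -/
theorem isUnit_of_isUnit_fst {x : R F} (ha : IsUnit x.1.1) : IsUnit x := by
  have hb : IsUnit x.1.2 := by
    rw [PowerSeries.isUnit_iff_constantCoeff] at ha ⊢
    exact (R.prop x) ▸ ha
  obtain ⟨ua, hua⟩ := ha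
  obtain ⟨ub, hub⟩ := hb
  have hθ : Units.map (θ F : A F →* A₂ F) ua = Units.map (θ F : A F →* A₂ F) ub := by
    refine Units.ext ?_
    rw [Units.coe_map, Units.coe_map, MonoidHom.coe_coe, hua, hub]
    exact R.prop x
  let y : R F := ⟨((↑ua⁻¹ : A F), (↑ub⁻¹ : A F)), by
    rw [mem_R]
    change ((Units.map (θ F : A F →* A₂ F) ua)⁻¹ : (A₂ F)ˣ).val =
      ((Units.map (θ F : A F →* A₂ F) ub)⁻¹ : (A₂ F)ˣ).val
    rw [hθ]⟩
  refine IsUnit.of_mul_eq_one y (Subtype.ext (Prod.ext ?_ ?_))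
  · change x.1.1 * ↑ua⁻¹ = 1
    rw [← hua, Units.mul_inv]
  · change x.1.2 * ↑ub⁻¹ = 1
    rw [← hub, Units.mul_inv]

/-- `R` is local. [folklore] -/
instance : IsLocalRing (R F) :=
  IsLocalRing.of_isUnit_or_isUnit_one_sub_self fun x => by
    rcases IsLocalRing.isUnit_or_isUnit_one_sub_self x.1.1 with h | h
    · exact Or.inl (isUnit_of_isUnit_fst F h)
    · exact Or.inr (isUnit_of_isUnit_fst F h)

/-- the diagonal `A`-algebra structure on `R`. [folklore] -/
instance : Algebra (A F) (R F) := (diag F).toAlgebra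

/-- the inclusion `R ⊆ A × A` is `A`-linear (diagonal action). [folklore] -/
def incl : R F →ₗ[A F] (A F × A F) where
  toFun := Subtype.val
  map_add' _ _ := rfl
  map_smul' a x := by
    rw [Algebra.smul_def, RingHom.id_apply]
    change (diag F a).1 * x.1 = a • x.1
    ext <;> simp [diag]

/-- `R` is module-finite over `A`. [folklore] -/
instance : Module.Finite (A F) (R F) := Module.Finite.of_injective (incl F) Subtype.val_injective

/-- `R` is Noetherian. [folklore] -/
instance : IsNoetherianRing (R F) := isNoetherian_of_tower (A F) inferInstance

/-- `t` is a non-zero-divisor. [folklore] -/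
theorem t_mem_nonZeroDivisors : t F ∈ nonZeroDivisors (R F) := by
  refine mem_nonZeroDivisors_iff.2 ⟨fun y hy => ?_, fun y hy => ?_⟩ <;>
  · have h1 := congrArg (fun z : R F => z.1.1) hy
    have h2 := congrArg (fun z : R F => z.1.2) hy
    simp only [t, Subring.coe_mul, Prod.fst_mul, Prod.snd_mul, ZeroMemClass.coe_zero,
      Prod.fst_zero, Prod.snd_zero, mul_eq_zero, PowerSeries.X_ne_zero, or_false, false_or] at h1 h2
    exact Subtype.ext (Prod.ext h1 h2)

/-- `t` is not a unit. [folklore] -/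
theorem t_not_isUnit : ¬ IsUnit (t F) := by
  intro h
  have h1 : IsUnit (PowerSeries.X : A F) := h.map (pr₁ F)
  rw [PowerSeries.isUnit_iff_constantCoeff, PowerSeries.constantCoeff_X] at h1
  exact not_isUnit_zero h1

/-- any ideal above both minimal primes contains `t`. [folklore] -/
theorem t_mem_of_le {P : Ideal (R F)} (h₁ : 𝔮₁ F ≤ P) (h₂ : 𝔮₂ F ≤ P) : t F ∈ P := by
  rw [t_eq]
  exact P.add_mem (h₂ (by simp [mem_𝔮₂, e₁])) (h₁ (by simp [mem_𝔮₁, e₂]))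

/-- `t` lies on the crossing prime `P₀`. [folklore] -/
theorem t_mem_sup : t F ∈ 𝔮₁ F ⊔ 𝔮₂ F := t_mem_of_le F le_sup_left le_sup_right

/-- `Spec R` is connected in dimension two (the only partition is `{Y} ⊔ {C}`, crossing at `P₀`). [folklore] -/
theorem isConnectedInDimTwo : IsConnectedInDimTwo (R F) := by
  intro 𝒜 h𝒜 ⟨q, hq⟩ ⟨q', hq'₁, hq'₂⟩
  have hqm : q ∈ minimalPrimes (R F) := h𝒜 hq
  have hne : q ≠ q' := fun h => hq'₂ (h ▸ hq)
  have h2 : (2 : WithBot ℕ∞) ≤ ringKrullDim (R F ⧸ (𝔮₁ F ⊔ 𝔮₂ F)) :=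
    (ringKrullDim_quotient_crossing F).ge
  refine ⟨q, hq, q', ⟨hq'₁, hq'₂⟩, ?_⟩
  rw [minimalPrimes_eq] at hqm hq'₁
  rcases hqm with rfl | rfl <;> rcases hq'₁ with rfl | rfl
  · exact absurd rfl hne
  · exact h2
  · rw [sup_comm]; exact h2
  · exact absurd rfl hne

end CharPWitness

open CharPWitness in
/-- **The char-`p` crossing primes are load-bearing.**  STUB 3 with the height-one criterion
restricted to primes avoiding a regular non-unit `t` is FALSE: witness `R = A ×_{A/ϖ} A`
(`A = ℚ⟦X⟧⟦Y⟧⟦Z⟧`, `ϖ = Z`), `t = (ϖ, ϖ)`, `I = K = 𝔮₁`.  All hypotheses hold — `yoshida_minimal`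
(`𝔮₁`), `connected₂` (`isConnectedInDimTwo`), `generic_propagation` (vacuous: one stable component),
the off-`t` height-one criterion (vacuous: a prime above `I = 𝔮₁` containing `𝔮₂` contains `P₀ ∋ t`) —
and the conclusion fails at `𝔮₂`. [folklore] -/
theorem not_stableComponentsModularOffElt : ¬ StableComponentsModularOffElt := by
  intro h
  have h1 : 𝔮₁ ℚ ∈ minimalPrimes (R ℚ) := by rw [minimalPrimes_eq]; exact Or.inl rfl
  have h2 : 𝔮₂ ℚ ∈ minimalPrimes (R ℚ) := by rw [minimalPrimes_eq]; exact Or.inr rfl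
  have key := h (R ℚ) (t ℚ) (𝔮₁ ℚ) (𝔮₁ ℚ) (t_mem_nonZeroDivisors ℚ) (t_not_isUnit ℚ) le_rfl
    ⟨𝔮₁ ℚ, h1, le_rfl⟩ (isConnectedInDimTwo ℚ)
    (fun 𝔮a _ 𝔮b _ hIa _ _ hKa => absurd hKa hIa)
    (fun P _ hIP _ htP 𝔮 h𝔮 h𝔮P => by
      rw [minimalPrimes_eq] at h𝔮
      rcases h𝔮 with rfl | rfl
      · exact le_rfl
      · exact absurd (t_mem_of_le ℚ hIP h𝔮P) htP)
    (𝔮₂ ℚ) h2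
  exact not_𝔮₁_le ℚ key

end Summit.Langlands.Langlands.Theorems.ResiduallyYoshidaLifting.Negative
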